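import Literature.MathematicalPhysics.QuantumFieldTheory.Balaban1983to89.B4Eq19LatticeGradientExcessDecay
import HarnessLib

/-!
# Route `UnitScaleTilt`, crux K1 «MinimiserStabilityRegPr» (stmt-QuantumFields-19200), route-R E′ path (α′), residue (hK), sub-row (N): POINTWISE GRADIENT OF A LATTICE-HARMONIC
# FUNCTION FROM ITS SIZE — `|∂_νh(z)| ≤ K_d·M∕ℓ` if `h` is `κ`-harmonic (`κ ≥ 0`) on `Q_{(d+2)ℓ+2d}(z)` with `|h| ≤ M` on `Q_{(d+2)ℓ+2d+2}(z)`; for `κ = 0` modulo constants.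
# With the Newtonian size `|G₁ − c| ≲ R⁻¹` on `Q_{R∕2}` this is the row `|∇G₁| ≲ R⁻²` that (N) feeds to ✓ `…NearFieldShellSum`.

Cell `ym3-torus`, D-0154 (3c) twin-width seat `ym-routeR-w3` (gen 5); ★p1 g14 17:33:03Z∕17:53:40Z «hInterp part (B)», standing PASS-at-dry-run 18:44:59Z; LOCATE #53 §7.  Composition of
the tree's De Giorgi letters ✓ `B4Eq19LatticeHarmonicDecay.sq_fdiff_le_of_harmonic` (interior `(∂h)² ≲ ℓ^{−d}·gradSq`) and ✓ `B4Eq19LatticeCaccioppoli.caccioppoli_harmonic`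
(`gradSq ≲ ℓ⁻²·Σh²`) with the box count ✓ `card_box`.  THEOREMS ONLY (0 `def`, 0 `sorry`); `--supports stmt-QuantumFields-19200`, count-neutral.  YM₃ on T³ is a ladder rung (R3),
not the Clay problem; nothing here claims the stub, the crux, d = 4 or the gap.

WHAT IS PROVED (ns `…Theorems.Prop7HarmonicGradientSup`; `Zd d` carrier, any `d ≥ 1`).
* `sum_sq_le_card_mul` (`Σ_{Q}h² ≤ #Q·M²` under `|h| ≤ M`), `card_box_le` (`#Q_{ρ}(z) ≤ ((4d+5)(ℓ+1))^d` for the radius used).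
* ★★★ `abs_fdiff_le_of_harmonic_sup` — `κ ≥ 0`, `ℓ ≥ 1`: `lop κ h = 0` on `Q_{2ℓ+d(ℓ+2)}(z)` and `|h y| ≤ M` on `Q_{2ℓ+d(ℓ+2)+2}(z)` ⇒ `|∂_νh(z)| ≤ K_d·M∕ℓ`,
  `K_d = √(14d·2^d(1+56d)^d(4d+5)^d)`.
* ★★ `abs_fdiff_le_of_harmonic_osc` — `κ = 0`: the same with `|h y − c| ≤ M` for any constant `c`.
HONEST SCOPE.  Elliptic bookkeeping over landed letters; the Newtonian size row (`|G₁ − c| ≲ R⁻¹`, [Lawler, *Intersections of Random Walks*, Thm 1.5.4]) is NOT here.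

References: M. Giaquinta, Ann. Math. Stud. 105 (1983), Ch. III §2 (2.4)–(2.5) pp.77–78 [Giaquinta1984]; T. Bałaban, CMP 96 (1984) 223–250 [Balaban1984PropagatorsII] ((1.9) p.226);
G. F. Lawler, *Intersections of Random Walks* (1991), Thm 1.5.4–1.5.5 (orientation only).
-/

set_option autoImplicit false

noncomputable section

open scoped BigOperators

namespace Summit.QuantumFields.YangMills.Theorems.Prop7HarmonicGradientSup

open Literature.MathematicalPhysics.QuantumFieldTheory.Balaban1983to89
open Finset B4Eq19LatticeOperators B4Eq19LatticeCaccioppoli B4Eq19LatticeHarmonicDecay B4Eq19LatticeGradientExcessDecay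

variable {d : ℕ}

/-- `Σ_{Q}h² ≤ #Q·M²` under `|h| ≤ M` on `Q`. [folklore] -/
theorem sum_sq_le_card_mul (Q : Finset (Zd d)) (h : Zd d → ℝ) {M : ℝ} (hM : ∀ y ∈ Q, |h y| ≤ M) :
    ∑ y ∈ Q, h y ^ 2 ≤ (Q.card : ℝ) * M ^ 2 := by
  calc ∑ y ∈ Q, h y ^ 2 ≤ ∑ _y ∈ Q, M ^ 2 := Finset.sum_le_sum fun y hy => by
          have := hM y hy
          have h0 : 0 ≤ M := (abs_nonneg _).trans this
          rw [← sq_abs]; exact pow_le_pow_left₀ (abs_nonneg _) this 2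
    _ = (Q.card : ℝ) * M ^ 2 := by rw [Finset.sum_const, nsmul_eq_mul]

/-- the box count at the Caccioppoli radius: `#Q_{2ℓ+d(ℓ+2)+2}(z) ≤ ((4d+5)(ℓ+1))^d`. [cite: Giaquinta1984, Ch. III §1 p.64] -/
theorem card_box_le (z : Zd d) (ℓ : ℕ) :
    ((box z (2 * (ℓ : ℤ) + d * ((ℓ : ℤ) + 2) + 2)).card : ℝ) ≤ ((4 * (d : ℝ) + 5) * ((ℓ : ℝ) + 1)) ^ d := by
  have hρ : (0 : ℤ) ≤ 2 * (ℓ : ℤ) + d * ((ℓ : ℤ) + 2) + 2 := by positivity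
  rw [card_box z hρ]
  have e : (((2 * (2 * (ℓ : ℤ) + d * ((ℓ : ℤ) + 2) + 2) + 1 : ℤ)) : ℝ) = (4 + 2 * (d : ℝ)) * ℓ + 4 * d + 5 := by push_cast; ring
  rw [e]
  have hd : (0 : ℝ) ≤ d := Nat.cast_nonneg d
  have hl : (0 : ℝ) ≤ ℓ := Nat.cast_nonneg ℓ
  exact pow_le_pow_left₀ (by positivity) (by nlinarith) d

/-- ★★★ **POINTWISE GRADIENT FROM SIZE for `κ`-harmonic functions (`κ ≥ 0`)**: `ℓ ≥ 1`, `lop κ h = 0` on `Q_{2ℓ+d(ℓ+2)}(z)`, `|h| ≤ M` on `Q_{2ℓ+d(ℓ+2)+2}(z)` ⇒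
`|∂_νh(z)| ≤ K_d·M∕ℓ`, `K_d = √(14d·2^d(1+56d)^d(4d+5)^d)` (interior estimate ✓ `sq_fdiff_le_of_harmonic` ∘ Caccioppoli ✓ `caccioppoli_harmonic` ∘ box count).
[cite: Giaquinta1984, Ch. III §2 (2.4)-(2.5) pp.77-78] -/
theorem abs_fdiff_le_of_harmonic_sup {κ : ℝ} (hκ : 0 ≤ κ) (z : Zd d) {ℓ : ℕ} (hℓ : 1 ≤ ℓ) (h : Zd d → ℝ) {M : ℝ}
    (hh : ∀ y ∈ box z (2 * (ℓ : ℤ) + d * ((ℓ : ℤ) + 2)), lop κ h y = 0)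
    (hM : ∀ y ∈ box z (2 * (ℓ : ℤ) + d * ((ℓ : ℤ) + 2) + 2), |h y| ≤ M) (ν : Fin d) :
    |fdiff ν h z| ≤ Real.sqrt (14 * d * (2 : ℝ) ^ d * (1 + 56 * d) ^ d * (4 * d + 5) ^ d) * M / ℓ := by
  have hl0 : (0 : ℝ) < ℓ := by exact_mod_cast hℓ
  have hl1 : (0 : ℝ) < (ℓ : ℝ) + 1 := by linarith
  have hd : (0 : ℝ) ≤ d := Nat.cast_nonneg d
  have hM0 : 0 ≤ M := (abs_nonneg _).trans (hM z (self_mem_box z (by positivity)))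
  -- interior estimate at `x = z`, `ρ₀ = 0`
  set ρ : ℤ := (ℓ : ℤ) + d * ((ℓ : ℤ) + 2) with hρdef
  have hρ0 : 0 ≤ ρ := by rw [hρdef]; positivity
  have hℓz : (1 : ℤ) ≤ ℓ := by exact_mod_cast hℓ
  have h1 := sq_fdiff_le_of_harmonic hκ (z := z) hℓ (le_refl (0 : ℤ)) h
    (fun y hy => hh y (box_mono z (by nlinarith [hd]) hy))
    (self_mem_box z le_rfl) ν
  simp only [zero_add] at h1
  -- Caccioppoli on `Q_ρ` with margin `s = ℓ`
  have h2 := caccioppoli_harmonic hκ h z hρ0 (by exact_mod_cast hℓ : (1 : ℤ) ≤ ℓ)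
    (fun y hy => hh y (box_mono z (by rw [hρdef]; linarith) hy))
  -- the mass on the Caccioppoli box
  have hbox : ρ + ℓ + 2 = 2 * (ℓ : ℤ) + d * ((ℓ : ℤ) + 2) + 2 := by rw [hρdef]; ring
  have h3 : ∑ y ∈ box z (ρ + ℓ + 2), h y ^ 2 ≤ ((4 * (d : ℝ) + 5) * ((ℓ : ℝ) + 1)) ^ d * M ^ 2 := by
    rw [hbox]
    exact (sum_sq_le_card_mul _ h hM).trans (mul_le_mul_of_nonneg_right (card_box_le z ℓ) (sq_nonneg M))
  -- assemble: `(∂h z)² ≤ C₁(ℓ+1)^{-d} · (14d/ℓ²) · ((4d+5)(ℓ+1))^d M²`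
  set R₀ : ℝ := 14 * d * (2 : ℝ) ^ d * (1 + 56 * d) ^ d * (4 * d + 5) ^ d with hR₀
  have hR₀0 : 0 ≤ R₀ := by positivity
  have hsq : fdiff ν h z ^ 2 ≤ R₀ * M ^ 2 / (ℓ : ℝ) ^ 2 := by
    calc fdiff ν h z ^ 2 ≤ (2 : ℝ) ^ d * (1 + 56 * d) ^ d / ((ℓ : ℝ) + 1) ^ d * gradSq h (box z ρ) := h1
      _ ≤ (2 : ℝ) ^ d * (1 + 56 * d) ^ d / ((ℓ : ℝ) + 1) ^ d * ((14 * d / (ℓ : ℝ) ^ 2) * (((4 * (d : ℝ) + 5) * ((ℓ : ℝ) + 1)) ^ d * M ^ 2)) :=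
          mul_le_mul_of_nonneg_left (h2.trans (mul_le_mul_of_nonneg_left h3 (by positivity))) (by positivity)
      _ = R₀ * M ^ 2 / (ℓ : ℝ) ^ 2 := by
          rw [hR₀, mul_pow]
          field_simp
  -- square roots
  have hK : Real.sqrt (R₀ * M ^ 2 / (ℓ : ℝ) ^ 2) = Real.sqrt R₀ * M / ℓ := by
    rw [Real.sqrt_div' _ (sq_nonneg _), Real.sqrt_mul' _ (sq_nonneg _), Real.sqrt_sq hM0, Real.sqrt_sq hl0.le]
  have := Real.abs_le_sqrt hsq
  rw [hK] at this
  exact this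

/-- ★★ **THE `κ = 0` FORM, MODULO CONSTANTS**: `lop 0 h = 0` on `Q_{2ℓ+d(ℓ+2)}(z)` and `|h y − c| ≤ M` on `Q_{2ℓ+d(ℓ+2)+2}(z)` ⇒ `|∂_νh(z)| ≤ K_d·M∕ℓ` — the form (N) uses with
the Newtonian size `|G₁(y) − c| ≲ R⁻¹` on `Q_{R∕(4d+5)}`-type boxes away from the pole, giving `|∇G₁| ≲ R⁻²`. [cite: Giaquinta1984, Ch. III §2 (2.5) p.78] -/
theorem abs_fdiff_le_of_harmonic_osc (z : Zd d) {ℓ : ℕ} (hℓ : 1 ≤ ℓ) (h : Zd d → ℝ) (c : ℝ) {M : ℝ}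
    (hh : ∀ y ∈ box z (2 * (ℓ : ℤ) + d * ((ℓ : ℤ) + 2)), lop 0 h y = 0)
    (hM : ∀ y ∈ box z (2 * (ℓ : ℤ) + d * ((ℓ : ℤ) + 2) + 2), |h y - c| ≤ M) (ν : Fin d) :
    |fdiff ν h z| ≤ Real.sqrt (14 * d * (2 : ℝ) ^ d * (1 + 56 * d) ^ d * (4 * d + 5) ^ d) * M / ℓ := by
  have e : fdiff ν h z = fdiff ν (fun y => h y - c) z := by rw [fdiff_apply, fdiff_apply]; ring
  rw [e]
  exact abs_fdiff_le_of_harmonic_sup le_rfl z hℓ (fun y => h y - c) (fun y hy => by rw [lop_zero_sub_const]; exact hh y hy) hM ν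

end Summit.QuantumFields.YangMills.Theorems.Prop7HarmonicGradientSup
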